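import Summits.QuantumFields.BalabanUV.Beta.GAN24.Push4
import Summits.QuantumFields.BalabanUV.Beta.GAN24.Push4TwoRate
import Literature.MathematicalPhysics.QuantumFieldTheory.Balaban1983to89.T4GaugeActionRatePair
import Literature.MathematicalPhysics.QuantumFieldTheory.Balaban1983to89.Beta.InfiniteVolumeRate

/-!
# `BalabanUV.Beta.GAN24.Push4Locality` — binder row G-an2-4 ∕ (CONV-C), W-slot road «W3» (SKELETON-W3 v0.2 §7.3 (T-marg); the row text
# `hTmarg` of the owner's END `WSlotT2OfPieces.shape_of_rows`), journal INTENT «W3-TMARG-CORE*» PART 2 of 2: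
# **THE FOUR-LEG PUSH PRESERVES BI-STENCIL LOCALITY UNDER BLOCK-DECAYING LEGS — ONE FREE BLOCK SUM, `L^{d+1}` DISPLAYED**

NOT IN PRINT; OUR PROOF ATTEMPT (G-an2-4 formalisation swarm, leaf prover `b2b-balaban-gan24-formalise-leaf-03`, gen 17; [folklore] real
analysis over leaf-17's DEFINED carrier `Push4.push₄`).  HONEST FRAMING (cell contract, verbatim): «discharging `BetaPertH` makes Bałaban's
UV stability UNCONDITIONAL — a real constructive-QFT result; it is NOT the continuum limit and NOT the Clay problem.»  HONEST DEPENDENCY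
(verbatim): «continuum YM on T⁴ ⇐ BetaPertH ∧ nine spine estimates (0/9 proved); BetaPertH ⇐ (D1) ∧ (D4) ∧ CAP+tail; G-an2-4 gates
asym, D1 and NE2/3/4.»

WHAT.  For ABSTRACT leg families `l r : Fin (d+1) → ℤ^{d+1} → Fin (d+1) → ℤ^{d+1} → ℝ` (coarse bond → fine bond) with SUP envelopes decaying
on the RELATIVE block scale `L` — (hl) `|l α x′ κ x| ≤ Al·e^{−m|quo L x − x′|₁}`, (hr) `|r β z′ κ z| ≤ Ar·e^{−m|quo L z − z′|₁}` (the currency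
of leaf-12's `RespStepDecay` after the `supNorm → ℓ¹` adapter) — and an ABSTRACT bi-stencil table `X` on the fine lattice with
`LocStencil₂ X C δ` (fine units):
* §1 **`abs_vertexW_slice_le`** — the INNER table leg: `|vertexW r (X κ u) ν y′ x z a b| ≤ (d+1)·Ar·C·Zl(δ/2)·e^{−η|quo L u − y′|₁}·
  e^{−δ(|x−u|₁+|z−u|₁)}`, `η := min m (δ/2)` (part 1's two-rate sum: the `u′`-sum is paid by `X`'s decay, the leg by its sup);
* §2 **`abs_vertex2W_le`** — BOTH table legs: `|vertex2W r X μ y ν y′ x z a b| ≤ (d+1)²·Ar²·C·Zl(δ/2)·Σ'_u (w u·e^{−δ|z−u|₁})·e^{−δ|x−u|₁}`,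
  `w u := e^{−m|quo L u − y|₁}·e^{−η|quo L u − y′|₁}` — the remaining `u`-sum is the FREE one;
* §3 **`locStencil₂_push₄`** — THE CORE OF (T-marg): `LocStencil₂ (push₄ l r X) (((d+1)^4·Zl(δ/2)^3·Zl(m/4)·Al·Ar^3·L^{d+1})·C) (min (m/4) (δ/2))`
  on the COARSE lattice in coarse units — the constant is LINEAR in `C` (the `CT * C` shape of `hTmarg`), the output rate is FREE of `L`,
  and the ONLY power of the relative blocking is the one free block sum `L^{d+1}` (part 1's `tsum_block_four_le`); the two kernel legs go
  through part 1's `abs_tsum_leg_le` (swap + two-rate sum), the fibre entries with a multiplier index vanish (`Push4.ffRead_inr_*`).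
* §4 **`push₄_locStencil₂`** — THE SAME IN THE ROW OWNER's (F3-core-a) CURRENCY (SKELETON-W3 v1.0 §8.6, leg envelopes = leaf-12's `RespStepDecay`
  shapes VERBATIM: `|r μ z κ u| ≤ A·((L:ℝ)^(d+2))⁻¹·e^{−κ₀‖quo L u − z‖∞}`): `LocStencil₂ (push₄ l r X) (K₄·A^4·C·L^{d+1}·(((L:ℝ)^(d+2))⁻¹)^4) δ′` with
  `K₄ = (d+1)^4·Zl(δ/2)^3·Zl(κ₀/(d+1)/4)` and `δ′ = min (κ₀/(d+1)/4) (δ/2)` FREE OF `L` — net power `L^{d+1−4(d+2)} = L^{−3d−7}` DISPLAYED.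
RELATION TO leaf-17's `Push4Bounds`∕`Push4LocStencil` (p-landed 07:3xZ, read after this file was written): their `locStencil₂_push₄` KEEPS the table's
rate and pays every superposition AT THE LEGS' rate `m` (`Zl(m−δ)^3·Zl(m−3δ)`, hypothesis `3δ < m`, legs `LegDecay` in FINE units) — the right budget for
ONE step with unit-scale legs; for the COMPOSITE push over `k` levels the legs' fine rate is `∼ κ₀/L` and those constants grow like `L^{4(d+1)}`.  THIS
file budgets the other way (three sums at the TABLE's rate, free of `L`; ONE block sum `L^{d+1}`), which is what the k-UNIFORM row (T-marg) needs; the two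
are complementary (theirs: first general step ∕ rate bookkeeping; this: the composite legs), neither restates the other.
HOW THE ROW USES IT (not here): with F1's identification `P m k X = (cE₂·Lc^{2(d+1)})^k • push₄ (composite legs) X` and the LEGS sup
`Al, Ar ∼ (L^{d+2})⁻¹` at `L = Lc^k` (leaf-12's `RespStepDecay` once the composite normalised legs are identified with `respStep`), the count is
`ĉ^k·L^{4(d+1)}·L^{−4(d+2)}·L^{d+1} = ĉ^k·L^{d−3}`, `ĉ := cE₂·Lc^{−2(d+1)}` — MARGINAL exactly at `d = 3`, bounded under the pin `|ĉ| ≤ 1`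
(SKELETON-W3 §7.3; the sup-currency twin of leaf-16-g11's zero-mode charge count E-W-0).
Nothing is cited, no `def … : Prop` is minted; asserts NO shape of Bałaban's tables; NOT the row (T-marg), NOT (T-irr); discharges NOTHING of
«T2Shape»∕«T2SupRate»∕(hW, hWall); 0∕2 wall binders; NOT «W-slot closed», NEVER «G-an2-4 closed»; NOT BetaPertH, NOT continuum, NOT Clay.
-/

noncomputable section

open Finset
open scoped BigOperators
open Literature.MathematicalPhysics.QuantumFieldTheory
open Literature.MathematicalPhysics.QuantumFieldTheory.Balaban1983to89
open Literature.MathematicalPhysics.QuantumFieldTheory.Balaban1983to89.Beta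
open B12Sec2to5 (l1 l1_nonneg)
open ExpKernelCalculus (MKer BiLoc Zl Zl_nonneg summable_exp_shift summable_exp_shift' tsum_exp_shift tsum_exp_shift' l1_sub_triangle
  l1_sub_symm)
open OneStepResolventKernel (Fib)
open BalabanCompositeJets (LocStencil₂)
open LatticeForm (quo)
open B4ContourShift (supNorm)
open T4GaugeActionRatePair (exp_sup_le_exp_l1)
open Summit.QuantumFields.BalabanUV.Beta.GAN24.Push4 (vertexW vertex2W push₄ vertexW_apply push₄_inl_inl push₄_def)
open Summit.QuantumFields.BalabanUV.Beta.GAN24.Push4TwoRate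

namespace Summit.QuantumFields.BalabanUV.Beta.GAN24.Push4Locality

variable {d : ℕ} {L : ℕ} {m δ Al Ar C : ℝ}
  {l r : Fin (d + 1) → (Fin (d + 1) → ℤ) → Fin (d + 1) → (Fin (d + 1) → ℤ) → ℝ}
  {X : Fin (d + 1) → (Fin (d + 1) → ℤ) → Fin (d + 1) → (Fin (d + 1) → ℤ) → MKer (d + 1) (Fib d)}

/-! ## §1 The inner table leg -/

/-- [folklore] **THE INNER TABLE LEG**: reading the second index of a `LocStencil₂` table through a leg with block-label decay gives, at
every first index `(κ, u)`, a kernel bi-localised at `u` with a constant decaying in the block label of `u`: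
`|vertexW r (X κ u) ν y′ x z a b| ≤ (d+1)·Ar·C·Zl_{d+1}(δ/2)·e^{−η|quo L u − y′|₁}·e^{−δ(|x − u|₁ + |z − u|₁)}`, `η = min m (δ/2)`. -/
theorem abs_vertexW_slice_le (hL : 1 ≤ L) (hm : 0 < m) (hδ : 0 < δ)
    (hr : ∀ β z' κ z, |r β z' κ z| ≤ Ar * Real.exp (-m * l1 (quo L z - z')))
    (hX : LocStencil₂ X C δ) (ν : Fin (d + 1)) (y' : Fin (d + 1) → ℤ)
    (κ : Fin (d + 1)) (u x z : Fin (d + 1) → ℤ) (a b : Fib d) :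
    |vertexW r (X κ u) ν y' x z a b|
      ≤ ((d + 1 : ℕ) : ℝ) * Ar * C * Zl (d + 1) (δ / 2) * Real.exp (-(min m (δ / 2)) * l1 (quo L u - y'))
          * Real.exp (-δ * (l1 (x - u) + l1 (z - u))) := by
  have hAr : 0 ≤ Ar := Beta.nonneg_of_abs_le_mul_exp (hr ν y' κ u)
  have hC : 0 ≤ C := hX.nonneg
  rw [vertexW_apply]
  refine (Finset.abs_sum_le_sum_abs _ _).trans ?_
  have hterm : ∀ κ' : Fin (d + 1), |∑' u', r ν y' κ' u' * X κ u κ' u' x z a b|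
      ≤ Ar * C * Zl (d + 1) (δ / 2) * Real.exp (-(min m (δ / 2)) * l1 (quo L u - y'))
          * Real.exp (-δ * (l1 (x - u) + l1 (z - u))) := by
    intro κ'
    have hpt : ∀ u' : Fin (d + 1) → ℤ, ‖r ν y' κ' u' * X κ u κ' u' x z a b‖
        ≤ (Ar * C * Real.exp (-δ * (l1 (x - u) + l1 (z - u))))
            * (Real.exp (-m * l1 (quo L u' - y')) * Real.exp (-δ * l1 (u' - u))) := by
      intro u'
      rw [Real.norm_eq_abs, abs_mul]
      have h1 := hr ν y' κ' u'
      have h2 : |X κ u κ' u' x z a b| ≤ C * Real.exp (-δ * l1 (u' - u)) * Real.exp (-δ * (l1 (x - u) + l1 (z - u))) :=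
        hX κ u κ' u' x z a b
      calc |r ν y' κ' u'| * |X κ u κ' u' x z a b|
          ≤ (Ar * Real.exp (-m * l1 (quo L u' - y')))
              * (C * Real.exp (-δ * l1 (u' - u)) * Real.exp (-δ * (l1 (x - u) + l1 (z - u)))) :=
            mul_le_mul h1 h2 (abs_nonneg _) (mul_nonneg hAr (Real.exp_pos _).le)
        _ = _ := by ring
    have hs : Summable fun u' : Fin (d + 1) → ℤ => (Ar * C * Real.exp (-δ * (l1 (x - u) + l1 (z - u))))
        * (Real.exp (-m * l1 (quo L u' - y')) * Real.exp (-δ * l1 (u' - u))) :=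
      (summable_two_rate hm.le hδ u y').mul_left _
    have h3 : |∑' u', r ν y' κ' u' * X κ u κ' u' x z a b| ≤ ∑' u' : Fin (d + 1) → ℤ,
        (Ar * C * Real.exp (-δ * (l1 (x - u) + l1 (z - u))))
          * (Real.exp (-m * l1 (quo L u' - y')) * Real.exp (-δ * l1 (u' - u))) := by
      have h := tsum_of_norm_bounded hs.hasSum hpt
      rwa [Real.norm_eq_abs] at h
    refine h3.trans ?_
    rw [tsum_mul_left]
    calc (Ar * C * Real.exp (-δ * (l1 (x - u) + l1 (z - u))))
          * ∑' u' : Fin (d + 1) → ℤ, Real.exp (-m * l1 (quo L u' - y')) * Real.exp (-δ * l1 (u' - u))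
        ≤ (Ar * C * Real.exp (-δ * (l1 (x - u) + l1 (z - u))))
          * (Zl (d + 1) (δ / 2) * Real.exp (-(min m (δ / 2)) * l1 (quo L u - y'))) :=
          mul_le_mul_of_nonneg_left (tsum_two_rate_le hL hm.le hδ u y') (by positivity)
      _ = _ := by ring
  calc ∑ κ', |∑' u', r ν y' κ' u' * X κ u κ' u' x z a b|
      ≤ ∑ κ' : Fin (d + 1), Ar * C * Zl (d + 1) (δ / 2) * Real.exp (-(min m (δ / 2)) * l1 (quo L u - y'))
          * Real.exp (-δ * (l1 (x - u) + l1 (z - u))) := Finset.sum_le_sum fun κ' _ => hterm κ'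
    _ = _ := by rw [Finset.sum_const, Finset.card_univ, Fintype.card_fin, nsmul_eq_mul]; ring

/-! ## §2 Both table legs -/

/-- [folklore] **BOTH TABLE LEGS**: with `w u := e^{−m|quo L u − y|₁}·e^{−η|quo L u − y′|₁}`,
`|vertex2W r X μ y ν y′ x z a b| ≤ (d+1)²·Ar²·C·Zl_{d+1}(δ/2)·Σ'_u (w u·e^{−δ|z − u|₁})·e^{−δ|x − u|₁}` — the first table leg's fine index
`u` is left unsummed against its leg weight: it is the one FREE block sum of the transport. -/
theorem abs_vertex2W_le (hL : 1 ≤ L) (hm : 0 < m) (hδ : 0 < δ)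
    (hr : ∀ β z' κ z, |r β z' κ z| ≤ Ar * Real.exp (-m * l1 (quo L z - z')))
    (hX : LocStencil₂ X C δ) (μ : Fin (d + 1)) (y : Fin (d + 1) → ℤ) (ν : Fin (d + 1)) (y' : Fin (d + 1) → ℤ)
    (x z : Fin (d + 1) → ℤ) (a b : Fib d) :
    |vertex2W r X μ y ν y' x z a b|
      ≤ ((d + 1 : ℕ) : ℝ) ^ 2 * Ar ^ 2 * C * Zl (d + 1) (δ / 2) *
          ∑' u : Fin (d + 1) → ℤ, (Real.exp (-m * l1 (quo L u - y)) * Real.exp (-(min m (δ / 2)) * l1 (quo L u - y'))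
            * Real.exp (-δ * l1 (z - u))) * Real.exp (-δ * l1 (x - u)) := by
  have hAr : 0 ≤ Ar := Beta.nonneg_of_abs_le_mul_exp (hr ν y' μ y)
  have hC : 0 ≤ C := hX.nonneg
  have hZ : 0 ≤ Zl (d + 1) (δ / 2) := Zl_nonneg (by linarith)
  -- the summand family of the free sum and its summability
  have hw0 : ∀ u : Fin (d + 1) → ℤ, 0 ≤ (Real.exp (-m * l1 (quo L u - y)) * Real.exp (-(min m (δ / 2)) * l1 (quo L u - y'))
      * Real.exp (-δ * l1 (z - u))) * Real.exp (-δ * l1 (x - u)) := fun u => by positivity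
  have hws : Summable fun u : Fin (d + 1) → ℤ => (Real.exp (-m * l1 (quo L u - y)) * Real.exp (-(min m (δ / 2)) * l1 (quo L u - y'))
      * Real.exp (-δ * l1 (z - u))) * Real.exp (-δ * l1 (x - u)) := by
    refine Summable.of_nonneg_of_le hw0 (fun u => ?_) (summable_exp_shift hδ x)
    have e0 : Real.exp (-m * l1 (quo L u - y)) ≤ 1 := Real.exp_le_one_iff.2 (by nlinarith [l1_nonneg (quo L u - y), hm.le])
    have e1 : Real.exp (-(min m (δ / 2)) * l1 (quo L u - y')) ≤ 1 :=
      Real.exp_le_one_iff.2 (by nlinarith [l1_nonneg (quo L u - y'), le_min hm.le (by linarith : (0:ℝ) ≤ δ / 2)])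
    have e2 : Real.exp (-δ * l1 (z - u)) ≤ 1 := Real.exp_le_one_iff.2 (by nlinarith [l1_nonneg (z - u), hδ.le])
    have p0 := Real.exp_pos (-m * l1 (quo L u - y))
    have p1 := Real.exp_pos (-(min m (δ / 2)) * l1 (quo L u - y'))
    have p3 := Real.exp_pos (-δ * l1 (x - u))
    calc (Real.exp (-m * l1 (quo L u - y)) * Real.exp (-(min m (δ / 2)) * l1 (quo L u - y')) * Real.exp (-δ * l1 (z - u)))
          * Real.exp (-δ * l1 (x - u))
        ≤ (1 * 1 * 1) * Real.exp (-δ * l1 (x - u)) := by gcongr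
      _ = Real.exp (-δ * l1 (x - u)) := by ring
  -- unfold the outer vertex
  have hv2 : vertex2W r X μ y ν y' x z a b = ∑ κ : Fin (d + 1), ∑' u : Fin (d + 1) → ℤ, r μ y κ u * vertexW r (X κ u) ν y' x z a b := by
    show vertexW r (fun κ u => vertexW r (X κ u) ν y') μ y x z a b = _
    rw [vertexW_apply]
  rw [hv2]
  refine (Finset.abs_sum_le_sum_abs _ _).trans ?_
  -- constant of §1
  set K₁ : ℝ := ((d + 1 : ℕ) : ℝ) * Ar * C * Zl (d + 1) (δ / 2) with hK₁
  have hK₁0 : 0 ≤ K₁ := by rw [hK₁]; positivity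
  have hterm : ∀ κ : Fin (d + 1), |∑' u : Fin (d + 1) → ℤ, r μ y κ u * vertexW r (X κ u) ν y' x z a b|
      ≤ Ar * K₁ * ∑' u : Fin (d + 1) → ℤ, (Real.exp (-m * l1 (quo L u - y)) * Real.exp (-(min m (δ / 2)) * l1 (quo L u - y'))
            * Real.exp (-δ * l1 (z - u))) * Real.exp (-δ * l1 (x - u)) := by
    intro κ
    have hpt : ∀ u : Fin (d + 1) → ℤ, ‖r μ y κ u * vertexW r (X κ u) ν y' x z a b‖
        ≤ (Ar * K₁) * ((Real.exp (-m * l1 (quo L u - y)) * Real.exp (-(min m (δ / 2)) * l1 (quo L u - y'))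
            * Real.exp (-δ * l1 (z - u))) * Real.exp (-δ * l1 (x - u))) := by
      intro u
      rw [Real.norm_eq_abs, abs_mul]
      have h1 := hr μ y κ u
      have h2 := abs_vertexW_slice_le hL hm hδ hr hX ν y' κ u x z a b
      calc |r μ y κ u| * |vertexW r (X κ u) ν y' x z a b|
          ≤ (Ar * Real.exp (-m * l1 (quo L u - y)))
              * (K₁ * Real.exp (-(min m (δ / 2)) * l1 (quo L u - y')) * Real.exp (-δ * (l1 (x - u) + l1 (z - u)))) :=
            mul_le_mul h1 (by rw [hK₁]; exact h2) (abs_nonneg _) (mul_nonneg hAr (Real.exp_pos _).le)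
        _ = _ := by rw [show -δ * (l1 (x - u) + l1 (z - u)) = -δ * l1 (x - u) + -δ * l1 (z - u) by ring, Real.exp_add]; ring
    have h := tsum_of_norm_bounded ((hws.mul_left (Ar * K₁)).hasSum) hpt
    rw [Real.norm_eq_abs] at h
    refine h.trans (le_of_eq ?_)
    rw [tsum_mul_left]
  calc ∑ κ, |∑' u : Fin (d + 1) → ℤ, r μ y κ u * vertexW r (X κ u) ν y' x z a b|
      ≤ ∑ κ : Fin (d + 1), Ar * K₁ * ∑' u : Fin (d + 1) → ℤ, (Real.exp (-m * l1 (quo L u - y))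
          * Real.exp (-(min m (δ / 2)) * l1 (quo L u - y')) * Real.exp (-δ * l1 (z - u))) * Real.exp (-δ * l1 (x - u)) :=
        Finset.sum_le_sum fun κ _ => hterm κ
    _ = _ := by rw [Finset.sum_const, Finset.card_univ, Fintype.card_fin, nsmul_eq_mul, hK₁]; ring

/-! ## §3 The four-leg push: the core of (T-marg) -/

/-- NOT IN PRINT; OUR PROOF.  **THE FOUR-LEG PUSH PRESERVES BI-STENCIL LOCALITY — THE ANALYTIC CORE OF ROW (T-marg)** (SKELETON-W3 v0.2 §7.3;
the `hTmarg` text of `WSlotT2OfPieces.shape_of_rows` for ONE push): for leg families with block-label sup envelopes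
(hl) `|l α x′ κ x| ≤ Al·e^{−m|quo L x − x′|₁}`, (hr) `|r β z′ κ z| ≤ Ar·e^{−m|quo L z − z′|₁}` (`m > 0`, relative blocking `L ≥ 1`) and a
table with `LocStencil₂ X C δ` (`δ > 0`, fine units), leaf-17's four-leg push is a `LocStencil₂` family on the COARSE lattice:
`LocStencil₂ (push₄ l r X) (((d+1)^4·Zl_{d+1}(δ/2)^3·Zl_{d+1}(m/4)·Al·Ar^3·L^{d+1})·C) (min (m/4) (δ/2))`.
The constant is LINEAR in `C`, the rate is FREE of `L`, and `L^{d+1}` — the one free block sum — is the ONLY power of the relative blocking: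
three of the four fine sums are paid by the table's own decay (`Zl(δ/2)^3`), the legs enter there by their SUP.  With composite legs of sup
`∼ (L^{d+2})⁻¹` and the scalar `(cE₂·Lc^{2(d+1)})^k` of F1 this is the marginal count `ĉ^k·L^{d−3}` of §7.3 (not performed here). -/
theorem locStencil₂_push₄ (hL : 1 ≤ L) (hm : 0 < m) (hδ : 0 < δ)
    (hl : ∀ α x' κ x, |l α x' κ x| ≤ Al * Real.exp (-m * l1 (quo L x - x')))
    (hr : ∀ β z' κ z, |r β z' κ z| ≤ Ar * Real.exp (-m * l1 (quo L z - z')))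
    (hX : LocStencil₂ X C δ) :
    LocStencil₂ (push₄ l r X)
      ((((d + 1 : ℕ) : ℝ) ^ 4 * Zl (d + 1) (δ / 2) ^ 3 * Zl (d + 1) (m / 4) * Al * Ar ^ 3 * (L : ℝ) ^ (d + 1)) * C)
      (min (m / 4) (δ / 2)) := by
  have hAl : 0 ≤ Al := Beta.nonneg_of_abs_le_mul_exp (hl 0 0 0 0)
  have hAr : 0 ≤ Ar := Beta.nonneg_of_abs_le_mul_exp (hr 0 0 0 0)
  have hC : 0 ≤ C := hX.nonneg
  have hZ : 0 ≤ Zl (d + 1) (δ / 2) := Zl_nonneg (by linarith)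
  have hZ4 : 0 ≤ Zl (d + 1) (m / 4) := Zl_nonneg (by linarith)
  have hη0 : 0 ≤ min m (δ / 2) := le_min hm.le (by linarith)
  have hL0 : (0 : ℝ) ≤ (L : ℝ) := Nat.cast_nonneg L
  intro μ y ν y' x' z' a b
  -- the target envelope
  have hRHS0 : 0 ≤ (((d + 1 : ℕ) : ℝ) ^ 4 * Zl (d + 1) (δ / 2) ^ 3 * Zl (d + 1) (m / 4) * Al * Ar ^ 3 * (L : ℝ) ^ (d + 1)) * C
      * Real.exp (-(min (m / 4) (δ / 2)) * l1 (y' - y)) * Real.exp (-(min (m / 4) (δ / 2)) * (l1 (x' - y) + l1 (z' - y))) := by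
    positivity
  rcases a with α | μ₁
  swap
  · rw [push₄_def, Push4.ffRead_inr_left, abs_zero]; exact hRHS0
  rcases b with β | ν₁
  swap
  · rw [push₄_def, Push4.ffRead_inr_right, abs_zero]; exact hRHS0
  -- the field–field entry
  rw [push₄_inl_inl]
  -- notation for the free-sum weight and the constants
  set K₂ : ℝ := ((d + 1 : ℕ) : ℝ) ^ 2 * Ar ^ 2 * C * Zl (d + 1) (δ / 2) with hK₂
  have hK₂0 : 0 ≤ K₂ := by rw [hK₂]; positivity
  set w : (Fin (d + 1) → ℤ) → ℝ := fun u => Real.exp (-m * l1 (quo L u - y)) * Real.exp (-(min m (δ / 2)) * l1 (quo L u - y'))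
    with hw
  have hw0 : ∀ u, 0 ≤ w u := fun u => by rw [hw]; positivity
  have hwle : ∀ u, w u ≤ Real.exp (-m * l1 (quo L u - y)) := fun u => by
    rw [hw]
    exact mul_le_of_le_one_right (Real.exp_pos _).le (Real.exp_le_one_iff.2 (by nlinarith [l1_nonneg (quo L u - y')]))
  have hws : Summable w := Summable.of_nonneg_of_le hw0 hwle (summable_leg (d := d) hL hm y)
  -- STEP A (the left kernel leg, for each `z κ₂`): `ψ_z u := w u · e^{−δ|z − u|₁}`
  have hψ0 : ∀ z u : Fin (d + 1) → ℤ, 0 ≤ w u * Real.exp (-δ * l1 (z - u)) := fun z u => mul_nonneg (hw0 u) (Real.exp_pos _).le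
  have hψs : ∀ z : Fin (d + 1) → ℤ, Summable fun u => w u * Real.exp (-δ * l1 (z - u)) := fun z =>
    Summable.of_nonneg_of_le (hψ0 z) (fun u => mul_le_of_le_one_right (hw0 u)
      (Real.exp_le_one_iff.2 (by nlinarith [l1_nonneg (z - u), hδ.le]))) hws
  have stepA : ∀ (z : Fin (d + 1) → ℤ) (κ₂ : Fin (d + 1)),
      |∑' x : Fin (d + 1) → ℤ, ∑ κ₁ : Fin (d + 1), l α x' κ₁ x * vertex2W r X μ y ν y' x z (Sum.inl κ₁) (Sum.inl κ₂)|
        ≤ (((d + 1 : ℕ) : ℝ) * Al * K₂) * Zl (d + 1) (δ / 2)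
            * ∑' u : Fin (d + 1) → ℤ, (w u * Real.exp (-δ * l1 (z - u))) * Real.exp (-(min m (δ / 2)) * l1 (quo L u - x')) := by
    intro z κ₂
    refine abs_tsum_leg_le hL hm hδ (by positivity) (hψ0 z) (hψs z) x' (F := fun x =>
      ∑ κ₁ : Fin (d + 1), l α x' κ₁ x * vertex2W r X μ y ν y' x z (Sum.inl κ₁) (Sum.inl κ₂)) (fun x => ?_)
    refine (Finset.abs_sum_le_sum_abs _ _).trans ?_
    have hterm : ∀ κ₁ : Fin (d + 1), |l α x' κ₁ x * vertex2W r X μ y ν y' x z (Sum.inl κ₁) (Sum.inl κ₂)|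
        ≤ Al * Real.exp (-m * l1 (quo L x - x')) * (K₂ * ∑' u : Fin (d + 1) → ℤ, (w u * Real.exp (-δ * l1 (z - u)))
            * Real.exp (-δ * l1 (x - u))) := by
      intro κ₁
      rw [abs_mul]
      have h1 := hl α x' κ₁ x
      have h2 := abs_vertex2W_le hL hm hδ hr hX μ y ν y' x z (Sum.inl κ₁) (Sum.inl κ₂)
      exact mul_le_mul h1 (by rw [hK₂, hw]; exact h2) (abs_nonneg _) (mul_nonneg hAl (Real.exp_pos _).le)
    calc ∑ κ₁, |l α x' κ₁ x * vertex2W r X μ y ν y' x z (Sum.inl κ₁) (Sum.inl κ₂)|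
        ≤ ∑ κ₁ : Fin (d + 1), Al * Real.exp (-m * l1 (quo L x - x')) * (K₂ * ∑' u : Fin (d + 1) → ℤ,
            (w u * Real.exp (-δ * l1 (z - u))) * Real.exp (-δ * l1 (x - u))) := Finset.sum_le_sum fun κ₁ _ => hterm κ₁
      _ = _ := by rw [Finset.sum_const, Finset.card_univ, Fintype.card_fin, nsmul_eq_mul]; ring
  -- STEP B+C (the right kernel leg): `ψ′ u := w u · e^{−η|quo L u − x′|₁}`
  have hψ'0 : ∀ u : Fin (d + 1) → ℤ, 0 ≤ w u * Real.exp (-(min m (δ / 2)) * l1 (quo L u - x')) := fun u =>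
    mul_nonneg (hw0 u) (Real.exp_pos _).le
  have hψ's : Summable fun u => w u * Real.exp (-(min m (δ / 2)) * l1 (quo L u - x')) :=
    Summable.of_nonneg_of_le hψ'0 (fun u => mul_le_of_le_one_right (hw0 u)
      (Real.exp_le_one_iff.2 (by nlinarith [l1_nonneg (quo L u - x')]))) hws
  set A' : ℝ := ((d + 1 : ℕ) : ℝ) * Ar * ((((d + 1 : ℕ) : ℝ) * Al * K₂) * Zl (d + 1) (δ / 2)) with hA'
  have hA'0 : 0 ≤ A' := by rw [hA']; positivity
  have stepC : |∑' z : Fin (d + 1) → ℤ, ∑ κ₂ : Fin (d + 1),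
        (∑' x : Fin (d + 1) → ℤ, ∑ κ₁ : Fin (d + 1), l α x' κ₁ x * vertex2W r X μ y ν y' x z (Sum.inl κ₁) (Sum.inl κ₂))
          * r β z' κ₂ z|
      ≤ A' * Zl (d + 1) (δ / 2) * ∑' u : Fin (d + 1) → ℤ,
          (w u * Real.exp (-(min m (δ / 2)) * l1 (quo L u - x'))) * Real.exp (-(min m (δ / 2)) * l1 (quo L u - z')) := by
    refine abs_tsum_leg_le hL hm hδ hA'0 hψ'0 hψ's z' (fun z => ?_)
    refine (Finset.abs_sum_le_sum_abs _ _).trans ?_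
    have hterm : ∀ κ₂ : Fin (d + 1),
        |(∑' x : Fin (d + 1) → ℤ, ∑ κ₁ : Fin (d + 1), l α x' κ₁ x * vertex2W r X μ y ν y' x z (Sum.inl κ₁) (Sum.inl κ₂))
            * r β z' κ₂ z|
          ≤ Ar * Real.exp (-m * l1 (quo L z - z')) * (((((d + 1 : ℕ) : ℝ) * Al * K₂) * Zl (d + 1) (δ / 2))
              * ∑' u : Fin (d + 1) → ℤ, (w u * Real.exp (-(min m (δ / 2)) * l1 (quo L u - x'))) * Real.exp (-δ * l1 (z - u))) := by
      intro κ₂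
      rw [abs_mul, mul_comm]
      have h1 := hr β z' κ₂ z
      have h2 := stepA z κ₂
      have h2' : |∑' x : Fin (d + 1) → ℤ, ∑ κ₁ : Fin (d + 1), l α x' κ₁ x * vertex2W r X μ y ν y' x z (Sum.inl κ₁) (Sum.inl κ₂)|
          ≤ ((((d + 1 : ℕ) : ℝ) * Al * K₂) * Zl (d + 1) (δ / 2))
              * ∑' u : Fin (d + 1) → ℤ, (w u * Real.exp (-(min m (δ / 2)) * l1 (quo L u - x'))) * Real.exp (-δ * l1 (z - u)) := by
        refine h2.trans (le_of_eq ?_)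
        congr 1
        exact tsum_congr fun u => by ring
      exact mul_le_mul h1 h2' (abs_nonneg _) (mul_nonneg hAr (Real.exp_pos _).le)
    calc ∑ κ₂, |(∑' x : Fin (d + 1) → ℤ, ∑ κ₁ : Fin (d + 1), l α x' κ₁ x * vertex2W r X μ y ν y' x z (Sum.inl κ₁) (Sum.inl κ₂))
            * r β z' κ₂ z|
        ≤ ∑ κ₂ : Fin (d + 1), Ar * Real.exp (-m * l1 (quo L z - z')) * (((((d + 1 : ℕ) : ℝ) * Al * K₂) * Zl (d + 1) (δ / 2))
              * ∑' u : Fin (d + 1) → ℤ, (w u * Real.exp (-(min m (δ / 2)) * l1 (quo L u - x'))) * Real.exp (-δ * l1 (z - u))) :=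
          Finset.sum_le_sum fun κ₂ _ => hterm κ₂
      _ = _ := by rw [Finset.sum_const, Finset.card_univ, Fintype.card_fin, nsmul_eq_mul, hA']; ring
  refine stepC.trans ?_
  -- STEP D: the one free block sum
  have stepD : ∑' u : Fin (d + 1) → ℤ,
        (w u * Real.exp (-(min m (δ / 2)) * l1 (quo L u - x'))) * Real.exp (-(min m (δ / 2)) * l1 (quo L u - z'))
      ≤ (L : ℝ) ^ (d + 1) * Zl (d + 1) (m / 4) *
          (Real.exp (-(min (m / 4) (min m (δ / 2))) * l1 (y' - y))
            * Real.exp (-(min (m / 4) (min m (δ / 2))) * (l1 (x' - y) + l1 (z' - y)))) := by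
    have h := tsum_block_four_le (d := d) hL hm hη0 y y' x' z'
    refine le_trans (le_of_eq (tsum_congr fun u => ?_)) h
    rw [hw]
  have hmin : min (m / 4) (min m (δ / 2)) = min (m / 4) (δ / 2) := by
    rw [← min_assoc, min_eq_left (by linarith : m / 4 ≤ m)]
  rw [hmin] at stepD
  calc A' * Zl (d + 1) (δ / 2) * ∑' u : Fin (d + 1) → ℤ,
          (w u * Real.exp (-(min m (δ / 2)) * l1 (quo L u - x'))) * Real.exp (-(min m (δ / 2)) * l1 (quo L u - z'))
      ≤ A' * Zl (d + 1) (δ / 2) * ((L : ℝ) ^ (d + 1) * Zl (d + 1) (m / 4) *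
          (Real.exp (-(min (m / 4) (δ / 2)) * l1 (y' - y)) * Real.exp (-(min (m / 4) (δ / 2)) * (l1 (x' - y) + l1 (z' - y))))) :=
        mul_le_mul_of_nonneg_left stepD (mul_nonneg hA'0 hZ)
    _ = _ := by rw [hA', hK₂]; ring

/-! ## §4 The same in the row owner's (F3-core-a) currency -/

/-- NOT IN PRINT; OUR PROOF.  **(F3-core-a) OF SKELETON-W3 v1.0 §8.6, VERBATIM CURRENCY**: with the leg envelopes in leaf-12's `RespStepDecay` shape —
(hl) `|l α x′ κ x| ≤ A·((L:ℝ)^(d+2))⁻¹·e^{−κ₀‖quo L x − x′‖∞}`, (hr) `|r μ z κ u| ≤ A·((L:ℝ)^(d+2))⁻¹·e^{−κ₀‖quo L u − z‖∞}` (`κ₀ > 0`, `L ≥ 1`) — and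
`LocStencil₂ X C δ` (`δ > 0`):
`LocStencil₂ (push₄ l r X) (((d+1)^4·Zl(δ/2)^3·Zl(κ₀/(d+1)/4))·A^4·C·L^{d+1}·(((L:ℝ)^(d+2))⁻¹)^4) (min (κ₀/(d+1)/4) (δ/2))` — the four-leg mass count with
EVERY power of the relative blocking displayed: net `L^{d+1−4(d+2)} = L^{−3d−7}`; with F1's scalar `(ĉ·Lc^{4(d+1)})^k` and `L = Lc^k` this is `ĉ^k·Lc^{k(d−3)}`
(§8.6; ≤ 1 at `d = 3` under the pin — the row's arithmetic, not performed here).  `§3` after the adapter `e^{−κ₀‖·‖∞} ≤ e^{−(κ₀/(d+1))|·|₁}`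
(`T4GaugeActionRatePair.exp_sup_le_exp_l1`). -/
theorem push₄_locStencil₂ {A κ₀ : ℝ} (hL : 1 ≤ L) (hδ : 0 < δ) (hκ₀ : 0 < κ₀)
    (hl : ∀ α x' κ x, |l α x' κ x| ≤ A * ((L : ℝ) ^ (d + 2))⁻¹ * Real.exp (-(κ₀ * supNorm (quo L x - x'))))
    (hr : ∀ μ z κ u, |r μ z κ u| ≤ A * ((L : ℝ) ^ (d + 2))⁻¹ * Real.exp (-(κ₀ * supNorm (quo L u - z))))
    (hX : LocStencil₂ X C δ) :
    LocStencil₂ (push₄ l r X)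
      ((((d + 1 : ℕ) : ℝ) ^ 4 * Zl (d + 1) (δ / 2) ^ 3 * Zl (d + 1) (κ₀ / ((d : ℝ) + 1) / 4)) * A ^ 4 * C * (L : ℝ) ^ (d + 1)
        * (((L : ℝ) ^ (d + 2))⁻¹) ^ 4)
      (min (κ₀ / ((d : ℝ) + 1) / 4) (δ / 2)) := by
  have hAc : 0 ≤ A * ((L : ℝ) ^ (d + 2))⁻¹ := Beta.nonneg_of_abs_le_mul_exp (hr 0 0 0 0)
  have hm : 0 < κ₀ / ((d : ℝ) + 1) := div_pos hκ₀ (by positivity)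
  have hl' : ∀ α x' κ x, |l α x' κ x| ≤ (A * ((L : ℝ) ^ (d + 2))⁻¹) * Real.exp (-(κ₀ / ((d : ℝ) + 1)) * l1 (quo L x - x')) :=
    fun α x' κ x => (hl α x' κ x).trans (mul_le_mul_of_nonneg_left (exp_sup_le_exp_l1 hκ₀.le _) hAc)
  have hr' : ∀ μ z κ u, |r μ z κ u| ≤ (A * ((L : ℝ) ^ (d + 2))⁻¹) * Real.exp (-(κ₀ / ((d : ℝ) + 1)) * l1 (quo L u - z)) :=
    fun μ z κ u => (hr μ z κ u).trans (mul_le_mul_of_nonneg_left (exp_sup_le_exp_l1 hκ₀.le _) hAc)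
  have h := locStencil₂_push₄ hL hm hδ hl' hr' hX
  have hK : ((d + 1 : ℕ) : ℝ) ^ 4 * Zl (d + 1) (δ / 2) ^ 3 * Zl (d + 1) (κ₀ / ((d : ℝ) + 1) / 4) * (A * ((L : ℝ) ^ (d + 2))⁻¹)
        * (A * ((L : ℝ) ^ (d + 2))⁻¹) ^ 3 * (L : ℝ) ^ (d + 1) * C
      = (((d + 1 : ℕ) : ℝ) ^ 4 * Zl (d + 1) (δ / 2) ^ 3 * Zl (d + 1) (κ₀ / ((d : ℝ) + 1) / 4)) * A ^ 4 * C * (L : ℝ) ^ (d + 1)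
        * (((L : ℝ) ^ (d + 2))⁻¹) ^ 4 := by ring
  rw [hK] at h
  exact h

end Summit.QuantumFields.BalabanUV.Beta.GAN24.Push4Locality

end
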